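import Literature.Geometry.Kaehler.ComplexTorusTotalLieAlgebraSimple
import Literature.Algebra.Lie.LefschetzTripleTransport
import HarnessLib

/-!
# Looijenga–Lunts (3.3) over `ℝ`: `(𝔤_tot(X; ℝ), h)` is a Jordan–Lefschetz pair for every complex torus `X`, and `(𝔰𝔬(V ⊕ V^*), u)` for `dim V ≥ 2`

Topic `Literature/Geometry/Kaehler` (namespace `Literature.Geometry.Kaehler.ComplexTorus`, continued).  Lane
`lit-hodgefound` (Track 2 foundations library), skeleton seat `lit-hodgefound-skel-1` (generation 52), row **A1-211** of
`run/shared/lean/pub/lit-hodgefound/SKELETON.md`.  Row A1-43 defined the total Lie algebra `𝔤_tot(X; ℝ)` of the complex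
torus `X = V/Λ` as the real Lie subalgebra of `𝔤𝔩(H•(X, ℂ))` generated by the `L_η` and `Λ` of the `𝔰𝔩₂`-triples
`(L_η, h, Λ)` (`h = countingG`); the tree identifies it with `𝔰𝔬(V ⊕ V^*)` for `g = dim_ℂ V ≥ 2`
(`totalLieAlgebraEquiv`, `u ↦ h`) and with `𝔰𝔩₂(ℝ)` for `g = 1` (`totalLieAlgebra_eq_toLieSubalgebra`), and proves it
semisimple for every `g ≥ 1` (`isSemisimple_totalLieAlgebra'`); row A1-85 proved the Jordan–Lefschetz property of the
`ℚ`-form `(𝔤_tot(X; ℚ), h)`.  This file proves the clause for the REAL Lie algebra, AS PRINTED in (3.3):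

* **`(𝔤_tot(X; ℝ), h)` is a Jordan–Lefschetz pair** (`Literature.Algebra.Lie.IsJordanLefschetzPair ℝ`, row A1-84) for
  every complex torus of dimension `g ≥ 1` (`isJordanLefschetzPair_totalLieAlgebra`): semisimple; `𝔞 = 𝔤_2` abelian
  because `𝔤_4 = 0` — for `g ≥ 2` this is "`u` defines a grading with degrees `2`, `0` and `-2`" transported from
  `𝔰𝔬(V ⊕ V^*)` (an elementary computation on `𝔤𝔩_ℝ(V ⊕ V^*)`, §1), for `g = 1` it is the `𝔰𝔩₂`-span; the frame
  form `ω₀` gives the triple `(L_{ω₀}, h, Λ_{ω₀})` INSIDE `𝔤_tot`; and generation by `𝔤_2 ∪ f(dom f)` is the very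
  definition of `𝔤_tot`;
* **`(𝔰𝔬(V ⊕ V^*), u)` is a Jordan–Lefschetz pair for `g ≥ 2`** (`isJordanLefschetzPair_so`) — "a real form of the case
  `(D_{2n}, A_{2n-1})`" — transported back along `totalLieAlgebraEquiv` (row A1-87 `IsJordanLefschetzPair.map`).

THEOREMS ONLY (no definition, no named fact, no `sorry`; net debt `0`); no local instance attribute (the Lie structure
of the ambient `𝔤𝔩(H•(X, ℂ))` is supplied inside proofs by `letI`; statements live in `↥𝔤_tot`, `↥𝔰𝔬`).

## Source, VERBATIM

E. Looijenga, V. A. Lunts, *A Lie algebra attached to a projective variety*, Invent. Math. **129** (1997) 361–412 (held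
TeX `paper:arxiv-alg-geom_9604014`), §3 (3.1) p. 13 L43–L49: "The semi-simple element `u := (-1_V, 1_{V^*}) ∈
𝔰𝔬(V ⊕ V^*)` defines a grading of the latter with degrees `2`, `0` and `-2`."; (3.3) Proposition, p. 13 L110–L115:
"There is a natural identification `(𝔤_tot(X; ℝ), h) ≅ (𝔰𝔬(V^* ⊕ V), u)`; this is a real form of the case
`(D_{2n}, A_{2n-1})`.  Furthermore, `H^{ev}(X)[n]` is a semispinorial representation of `𝔤_tot(X; ℝ)` and a fundamental
Jordan–Lefschetz module of `H²(X, ℝ)`."; §1 p. 7 L54–L78 (Lefschetz triples (i), (ii)); §2 p. 9 L109–L111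
(Jordan–Lefschetz pairs); (2.6) p. 10 L16–L31 ("`(D_{2m}, A_{2m-1})` (`m ≥ 2`)").

## Contents (all proved)

* §1 **`eq_zero_of_lie_gradingElement_eq_smul_end`** (no eigenvalue of `ad u` on `𝔤𝔩_ℝ(V ⊕ V^*)` other than
  `-2, 0, 2`; any complex normed space `V`);
* §2 `adDegree_so_gradingElement_eq_bot` (`𝔤_c(u) = 0` in `𝔰𝔬(V ⊕ V^*)` for `c ∉ {-2, 0, 2}`);
* §3 `totalLieAlgebraEquiv_gradingElement_eq`, **`adDegree_totalLieAlgebra_eq_bot`** (all `g ≥ 1`),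
  **`lie_eq_zero_of_mem_adDegree_two_totalLieAlgebra`** (`𝔤_2` abelian);
* §4 `lefschetzG_mem_adDegree_two_totalLieAlgebra`, `isSl2Triple_totalLieAlgebra`,
  `lefschetzG_mem_lefschetzDomain_totalLieAlgebra`;
* §5 **`lieSpan_adDegree_two_union_lefschetzDuals_totalLieAlgebra`**, **`isJordanLefschetzPair_totalLieAlgebra`**,
  `isLefschetzPair_totalLieAlgebra`, **`isJordanLefschetzPair_so`** (`g ≥ 2`), `isLefschetzPair_so`.

## SCOPE (what is NOT formalised here)

The negative for `g = 1` ("`(𝔰𝔬(2,2), u)` is not a Lefschetz pair", the excluded `n = 2` of (2.6), cf. row A1-193 in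
matrix form) is not restated on `so E`; the module clause of (3.3) (`H^{ev}(X)[n]` semispinorial, a fundamental
Jordan–Lefschetz module) is rows A1-45 / A1-76's business.  Nothing here concerns the Hodge conjecture.

## References

* [LooijengaLunts1997] E. Looijenga, V. A. Lunts, *A Lie algebra attached to a projective variety*, Invent. Math. 129
  (1997) 361–412; arXiv:alg-geom/9604014. §1 p. 7, §2 p. 9–10, §3 (3.1), (3.3) p. 13 (held `paper:arxiv-alg-geom_9604014`).
-/

namespace Literature.Geometry.Kaehler.ComplexTorus

open Module Function Literature.Algebra.Lie Literature.LinearAlgebra.Alternating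

variable (E : Type*) [NormedAddCommGroup E] [NormedSpace ℂ E]

/-! ### §1 No eigenvalue of `ad u` on `𝔤𝔩_ℝ(V ⊕ V^*)` other than `-2, 0, 2` -/

variable {E} in
/-- **Only the degrees `-2, 0, 2` occur under `ad u` on `𝔤𝔩_ℝ(V ⊕ V^*)`**, `u = (-1_V, 1_{V^*})`: if
`[u, T] = c T` with `c ∉ {-2, 0, 2}` then `T = 0` (evaluate on `V ⊕ 0` and `0 ⊕ V^*`, where `u = ∓1`).
[cite: LooijengaLunts1997, §3 (3.1) p. 13 L43–L49 ("u := (−1_V, 1_{V^*}) ∈ 𝔰𝔬(V ⊕ V^*) defines a grading of the latter with degrees 2, 0 and −2")] -/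
theorem eq_zero_of_lie_gradingElement_eq_smul_end {T : Module.End ℝ (sumDual E)} {c : ℝ} (h2 : c ≠ 2) (h0 : c ≠ 0)
    (hn2 : c ≠ -2) (h : ⁅gradingElement E, T⁆ = c • T) : T = 0 := by
  have key : ∀ v, gradingElement E (T v) - T (gradingElement E v) = c • T v := fun v ↦ by
    have hv := LinearMap.congr_fun h v
    rwa [Ring.lie_def, LinearMap.sub_apply, Module.End.mul_apply, Module.End.mul_apply, LinearMap.smul_apply] at hv
  have hL : ∀ x : E, T (x, 0) = 0 := fun x ↦ by
    have hk := key (x, 0)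
    have hneg : T ((-x : E), (0 : E →L[ℝ] ℝ)) = -T (x, 0) := by rw [← map_neg, Prod.neg_mk, neg_zero]
    rw [gradingElement_apply, gradingElement_apply, hneg, sub_neg_eq_add] at hk
    obtain ⟨hk1, hk2⟩ := Prod.ext_iff.1 hk
    simp only [Prod.fst_add, Prod.snd_add, Prod.smul_fst, Prod.smul_snd, neg_add_cancel] at hk1 hk2
    refine Prod.ext ?_ ?_
    · rw [eq_comm, smul_eq_zero] at hk1
      exact hk1.resolve_left h0
    · rw [← two_smul ℝ, ← sub_eq_zero, ← sub_smul, smul_eq_zero, sub_eq_zero] at hk2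
      exact hk2.resolve_left fun h ↦ h2 h.symm
  have hR : ∀ ξ : E →L[ℝ] ℝ, T (0, ξ) = 0 := fun ξ ↦ by
    have hk := key (0, ξ)
    rw [gradingElement_apply, gradingElement_apply, neg_zero] at hk
    obtain ⟨hk1, hk2⟩ := Prod.ext_iff.1 hk
    simp only [Prod.fst_sub, Prod.snd_sub, Prod.smul_fst, Prod.smul_snd, sub_self] at hk1 hk2
    refine Prod.ext ?_ ?_
    · -- `hk1 : -(T(0,ξ)).1 - (T(0,ξ)).1 = c • (T(0,ξ)).1`
      rw [← neg_add', ← two_smul ℝ, ← neg_smul, ← sub_eq_zero, ← sub_smul, smul_eq_zero, sub_eq_zero] at hk1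
      exact hk1.resolve_left fun h ↦ hn2 (by rw [← h])
    · rw [eq_comm, smul_eq_zero] at hk2
      exact hk2.resolve_left h0
  refine LinearMap.ext fun v ↦ ?_
  have hv : v = (v.1, 0) + (0, v.2) := by ext <;> simp
  rw [hv, map_add, hL, hR, add_zero, LinearMap.zero_apply]

/-! ### §2 `(𝔰𝔬(V ⊕ V^*), u)`: only the degrees `-2, 0, 2` -/

variable [FiniteDimensional ℂ E]

/-- `𝔤_c(u) = 0` in `𝔰𝔬(V ⊕ V^*)` for `c ∉ {-2, 0, 2}`. [cite: LooijengaLunts1997, §3 (3.1) p. 13 L43–L49] -/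
theorem adDegree_so_gradingElement_eq_bot {c : ℝ} (h2 : c ≠ 2) (h0 : c ≠ 0) (hn2 : c ≠ -2) :
    adDegree ℝ (⟨gradingElement E, gradingElement_mem_so E⟩ : so E) c = ⊥ :=
  (Submodule.eq_bot_iff _).2 fun _ hT ↦
    Subtype.ext (eq_zero_of_lie_gradingElement_eq_smul_end h2 h0 hn2 (congrArg Subtype.val (mem_adDegree_iff.1 hT)))

/-! ### §3 `(𝔤_tot(X; ℝ), h)`: only the degrees `-2, 0, 2`; `𝔤_2` is abelian -/

variable [Nontrivial E]

/-- For `g ≥ 2` the identification `𝔰𝔬(V ⊕ V^*) ≅ 𝔤_tot(X; ℝ)` carries `u` to `h` (tree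
`totalLieAlgebraEquiv_gradingElement`, as an equality of elements). [cite: LooijengaLunts1997, §3 (3.3) p. 13 L110–L112 ("(𝔤_tot(X;ℝ), h) ≅ (𝔰𝔬(V^* ⊕ V), u)")] -/
theorem totalLieAlgebraEquiv_gradingElement_eq (h2 : 2 ≤ finrank ℂ E) :
    totalLieAlgebraEquiv E h2 ⟨gradingElement E, gradingElement_mem_so E⟩ =
      (⟨countingG E, countingG_mem_totalLieAlgebra' E⟩ : totalLieAlgebra E) :=
  Subtype.ext (totalLieAlgebraEquiv_gradingElement E h2)

/-- **`𝔤_c(h) = 0` in `𝔤_tot(X; ℝ)` for `c ∉ {-2, 0, 2}`, every complex torus of dimension `g ≥ 1`**: for `g ≥ 2`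
transported from `𝔰𝔬(V ⊕ V^*)` (§2); for `g = 1`, `𝔤_tot(X; ℝ) = ℝh ⊕ ℝL ⊕ ℝΛ` is spanned by an `𝔰𝔩₂`-triple (tree
`totalLieAlgebra_eq_toLieSubalgebra`, row A1-84 `adDegree_eq_bot_of_isSl2Triple`). [cite: LooijengaLunts1997, §1 (1.1) p. 4 L56 ("𝔤(𝔞, M) is evenly graded"), §3 (3.2)–(3.3)] -/
theorem adDegree_totalLieAlgebra_eq_bot {c : ℝ} (h2 : c ≠ 2) (h0 : c ≠ 0) (hn2 : c ≠ -2) :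
    adDegree ℝ (⟨countingG E, countingG_mem_totalLieAlgebra' E⟩ : totalLieAlgebra E) c = ⊥ := by
  letI : LieRing (Module.End ℂ (GForm E ℂ)) := LieRing.ofAssociativeRing
  by_cases h1 : finrank ℂ E = 1
  · -- `g = 1`: `𝔤_tot` is spanned by the triple of a frame form
    have h2r : finrank ℝ E = 1 + 1 := by rw [finrank_real_of_complex, h1]
    let b : Module.Basis (Fin 1 ⊕ Fin 1) ℝ E := (Module.finBasis ℝ E).reindex ((finCongr h2r).trans finSumFinEquiv.symm)
    have t := isSl2Triple (frameForm_nondegenerate b)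
    have t' : IsSl2Triple (⟨countingG E, countingG_mem_totalLieAlgebra' E⟩ : totalLieAlgebra E)
        ⟨lefschetzG (frameForm b), lefschetzG_mem_totalLieAlgebra t⟩
        ⟨lefschetzDualG (frameForm b), mem_totalLieAlgebra_of_isSl2Triple t⟩ :=
      { h_ne_zero := fun h0' ↦ countingG_ne_zero (E := E) (congrArg Subtype.val h0')
        lie_e_f := Subtype.ext t.lie_e_f
        lie_h_e_nsmul := Subtype.ext t.lie_h_e_nsmul
        lie_h_f_nsmul := Subtype.ext t.lie_h_f_nsmul }
    refine adDegree_eq_bot_of_isSl2Triple t' (fun x ↦ ?_) hn2 h0 h2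
    have hx : (x : Module.End ℂ (GForm E ℂ)) ∈ t.toLieSubalgebra ℝ := by
      rw [← totalLieAlgebra_eq_toLieSubalgebra b]; exact x.2
    obtain ⟨c₁, c₂, c₃, hx'⟩ := IsSl2Triple.mem_toLieSubalgebra_iff.1 hx
    refine ⟨c₃, c₁, c₂, Subtype.ext ?_⟩
    change (x : Module.End ℂ (GForm E ℂ)) = c₃ • countingG E + c₁ • lefschetzG (frameForm b) + c₂ • lefschetzDualG (frameForm b)
    rw [hx', t.lie_e_f]
    abel
  · -- `g ≥ 2`: transport from `𝔰𝔬(V ⊕ V^*)`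
    have h2' : 2 ≤ finrank ℂ E := by have := Module.finrank_pos (R := ℂ) (M := E); omega
    rw [← totalLieAlgebraEquiv_gradingElement_eq E h2', ← map_adDegree, adDegree_so_gradingElement_eq_bot E h2 h0 hn2,
      Submodule.map_bot]

/-- **`𝔤_2` is abelian** (`[𝔤_2, 𝔤_2] ⊆ 𝔤_4 = 0`). [cite: LooijengaLunts1997, §2 (2.2) p. 9 L116, §3 (3.3)] -/
theorem lie_eq_zero_of_mem_adDegree_two_totalLieAlgebra {a b : totalLieAlgebra E}
    (ha : a ∈ adDegree ℝ (⟨countingG E, countingG_mem_totalLieAlgebra' E⟩ : totalLieAlgebra E) 2)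
    (hb : b ∈ adDegree ℝ (⟨countingG E, countingG_mem_totalLieAlgebra' E⟩ : totalLieAlgebra E) 2) : ⁅a, b⁆ = 0 := by
  have h := lie_mem_adDegree ha hb
  rw [show (2 : ℝ) + 2 = 4 by norm_num, adDegree_totalLieAlgebra_eq_bot E (by norm_num) (by norm_num) (by norm_num),
    Submodule.mem_bot] at h
  exact h

/-! ### §4 The `𝔰𝔩₂`-triples `(L_η, h, Λ_η)` inside `𝔤_tot(X; ℝ)` -/

variable {E} in
/-- `L_η ∈ 𝔤_2` for every non-degenerate real `2`-form `η`. [cite: LooijengaLunts1997, §1 (1.1) p. 3 L106–L111] -/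
theorem lefschetzG_mem_adDegree_two_totalLieAlgebra {η : E [⋀^Fin 2]→L[ℝ] ℝ}
    (hnd : ∀ v : E, v ≠ 0 → ∃ w : E, η ![v, w] ≠ 0) :
    (⟨lefschetzG η, lefschetzG_mem_totalLieAlgebra_of_nondegenerate hnd⟩ : totalLieAlgebra E) ∈
      adDegree ℝ (⟨countingG E, countingG_mem_totalLieAlgebra' E⟩ : totalLieAlgebra E) 2 := by
  rw [mem_adDegree_iff]
  apply Subtype.ext
  change ⁅countingG E, lefschetzG η⁆ = (2 : ℝ) • lefschetzG η
  rw [lie_countingG_lefschetzG, two_smul, two_smul]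

variable {E} in
/-- The `𝔰𝔩₂`-triple `(L_η, h, Λ_η)` of a non-degenerate real `2`-form is an `𝔰𝔩₂`-triple INSIDE `𝔤_tot(X; ℝ)`.
[cite: LooijengaLunts1997, §1 (1.1) p. 4 L1–L5, §3 (3.3)] -/
theorem isSl2Triple_totalLieAlgebra {η : E [⋀^Fin 2]→L[ℝ] ℝ} (hnd : ∀ v : E, v ≠ 0 → ∃ w : E, η ![v, w] ≠ 0) :
    IsSl2Triple (⟨countingG E, countingG_mem_totalLieAlgebra' E⟩ : totalLieAlgebra E)
      ⟨lefschetzG η, lefschetzG_mem_totalLieAlgebra_of_nondegenerate hnd⟩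
      ⟨lefschetzDualG η, mem_totalLieAlgebra_of_isSl2Triple (isSl2Triple hnd)⟩ := by
  letI : LieRing (Module.End ℂ (GForm E ℂ)) := LieRing.ofAssociativeRing
  have t := isSl2Triple hnd
  exact
    { h_ne_zero := fun h0 ↦ countingG_ne_zero (E := E) (congrArg Subtype.val h0)
      lie_e_f := Subtype.ext t.lie_e_f
      lie_h_e_nsmul := Subtype.ext t.lie_h_e_nsmul
      lie_h_f_nsmul := Subtype.ext t.lie_h_f_nsmul }

/-- The domain of `f` on `𝔞 = 𝔤_2` is non-empty (the frame form `ω₀`). [cite: LooijengaLunts1997, §1 p. 7 L54–L66, §3 (3.3)] -/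
theorem lefschetzG_mem_lefschetzDomain_totalLieAlgebra :
    (⟨lefschetzG (frameForm (cxFrame E)), lefschetzG_mem_totalLieAlgebra_of_nondegenerate
        (frameForm_nondegenerate (cxFrame E))⟩ : totalLieAlgebra E) ∈
      lefschetzDomain ℝ (⟨countingG E, countingG_mem_totalLieAlgebra' E⟩ : totalLieAlgebra E)
        (adDegree ℝ (⟨countingG E, countingG_mem_totalLieAlgebra' E⟩ : totalLieAlgebra E) 2) :=
  mem_lefschetzDomain_iff.2 ⟨lefschetzG_mem_adDegree_two_totalLieAlgebra (frameForm_nondegenerate (cxFrame E)), _,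
    isSl2Triple_totalLieAlgebra (frameForm_nondegenerate (cxFrame E))⟩

/-! ### §5 `(𝔤_tot(X; ℝ), h)` is a Jordan–Lefschetz pair over `ℝ` -/

/-- **Generation**: `𝔤_tot(X; ℝ)` is generated by `𝔤_2` and the image of `f` — it is DEFINED (row A1-43) as the Lie
algebra generated by the `L_η` and `Λ` of the `𝔰𝔩₂`-triples `(L_η, h, Λ)`. [cite: LooijengaLunts1997, §1 p. 7 L64–L66, (1.1) p. 4 L34–L37 ("𝔤(𝔞, M) denote the Lie subalgebra of 𝔤𝔩(M) generated by the transformations e_a, f_a"), (1.9)] -/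
theorem lieSpan_adDegree_two_union_lefschetzDuals_totalLieAlgebra :
    LieSubalgebra.lieSpan ℝ (totalLieAlgebra E)
        ((adDegree ℝ (⟨countingG E, countingG_mem_totalLieAlgebra' E⟩ : totalLieAlgebra E) 2 :
            Set (totalLieAlgebra E)) ∪
          lefschetzDuals ℝ (⟨countingG E, countingG_mem_totalLieAlgebra' E⟩ : totalLieAlgebra E)
            (adDegree ℝ (⟨countingG E, countingG_mem_totalLieAlgebra' E⟩ : totalLieAlgebra E) 2)) = ⊤ := by
  letI : LieRing (Module.End ℂ (GForm E ℂ)) := LieRing.ofAssociativeRing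
  set hT : totalLieAlgebra E := ⟨countingG E, countingG_mem_totalLieAlgebra' E⟩ with hhT
  set S := LieSubalgebra.lieSpan ℝ (totalLieAlgebra E)
    ((adDegree ℝ hT 2 : Set (totalLieAlgebra E)) ∪ lefschetzDuals ℝ hT (adDegree ℝ hT 2)) with hS
  have hle : totalLieAlgebra E ≤ S.map (totalLieAlgebra E).incl := by
    refine LieSubalgebra.lieSpan_le.2 ?_
    rintro T ⟨η, Λ, t, hT'⟩
    have t' : IsSl2Triple hT ⟨lefschetzG η, lefschetzG_mem_totalLieAlgebra t⟩ ⟨Λ, mem_totalLieAlgebra_of_isSl2Triple t⟩ :=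
      { h_ne_zero := fun h0 ↦ countingG_ne_zero (E := E) (congrArg Subtype.val h0)
        lie_e_f := Subtype.ext t.lie_e_f
        lie_h_e_nsmul := Subtype.ext t.lie_h_e_nsmul
        lie_h_f_nsmul := Subtype.ext t.lie_h_f_nsmul }
    rcases hT' with rfl | rfl
    · exact ⟨⟨lefschetzG η, lefschetzG_mem_totalLieAlgebra t⟩, LieSubalgebra.subset_lieSpan (Or.inl (e_mem_adDegree t')),
        rfl⟩
    · exact ⟨⟨T, mem_totalLieAlgebra_of_isSl2Triple t⟩,
        LieSubalgebra.subset_lieSpan (Or.inr (mem_lefschetzDuals_iff.2 ⟨_, e_mem_adDegree t', t'⟩)), rfl⟩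
  refine eq_top_iff.2 fun x _ ↦ ?_
  obtain ⟨y, hy, hyx⟩ := hle x.2
  have hyx' : y = x := Subtype.ext hyx
  rw [← hyx']
  exact hy

/-- **Looijenga–Lunts (3.3): `(𝔤_tot(X; ℝ), h)` IS A JORDAN–LEFSCHETZ PAIR over `ℝ`** for EVERY complex torus `X` of
dimension `g ≥ 1` (type `(D_{2g}, A_{2g-1})` for `g ≥ 2`, `(A_1, ∅)` for `g = 1`): semisimple (tree
`isSemisimple_totalLieAlgebra'`), `𝔞 = 𝔤_2` abelian (§3), the triple `(L_{ω₀}, h, Λ_{ω₀})` (§4), generation (§5).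
[cite: LooijengaLunts1997, §3 (3.3) p. 13 L110–L115 ("(𝔤_tot(X;ℝ), h) ≅ (𝔰𝔬(V^* ⊕ V), u); this is a real form of the case (D_{2n}, A_{2n−1}) … a fundamental Jordan–Lefschetz module of H²(X, ℝ)"), §1 (1.9)] -/
theorem isJordanLefschetzPair_totalLieAlgebra :
    IsJordanLefschetzPair ℝ (⟨countingG E, countingG_mem_totalLieAlgebra' E⟩ : totalLieAlgebra E) :=
  ⟨isSemisimple_totalLieAlgebra' E, le_rfl, fun _ ha _ hb ↦ lie_eq_zero_of_mem_adDegree_two_totalLieAlgebra E ha hb,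
    ⟨_, lefschetzG_mem_lefschetzDomain_totalLieAlgebra E⟩, lieSpan_adDegree_two_union_lefschetzDuals_totalLieAlgebra E⟩

/-- Hence `(𝔤_tot(X; ℝ), h)` is a Lefschetz pair. [cite: LooijengaLunts1997, §1 p. 7 L77–L78, §3 (3.3)] -/
theorem isLefschetzPair_totalLieAlgebra :
    IsLefschetzPair ℝ (⟨countingG E, countingG_mem_totalLieAlgebra' E⟩ : totalLieAlgebra E) :=
  (isJordanLefschetzPair_totalLieAlgebra E).isLefschetzPair

/-- **`(𝔰𝔬(V ⊕ V^*), u)` is a Jordan–Lefschetz pair over `ℝ` for `dim_ℂ V = g ≥ 2`** — "a real form of the case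
`(D_{2n}, A_{2n-1})`" — transported along `𝔰𝔬(V ⊕ V^*) ≅ 𝔤_tot(X; ℝ)`, `u ↦ h` (row A1-87 `IsJordanLefschetzPair.map`).
(For `g = 1`, `(𝔰𝔬(2,2), u)` is NOT a Lefschetz pair: the excluded case `n = 2` of (2.6), row A1-193.)
[cite: LooijengaLunts1997, §3 (3.3) p. 13 L110–L112, (2.6) p. 10 L25 ("(D_m, D_{m−1}) (m ≥ 5)"), L27 ("(D_{2m}, A_{2m−1}) (m ≥ 2)")] -/
theorem isJordanLefschetzPair_so (h2 : 2 ≤ finrank ℂ E) :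
    IsJordanLefschetzPair ℝ (⟨gradingElement E, gradingElement_mem_so E⟩ : so E) := by
  have J := (isJordanLefschetzPair_totalLieAlgebra E).map (totalLieAlgebraEquiv E h2).symm
  rwa [← totalLieAlgebraEquiv_gradingElement_eq E h2, LieEquiv.symm_apply_apply] at J

/-- `(𝔰𝔬(V ⊕ V^*), u)` is a Lefschetz pair (`g ≥ 2`). [cite: LooijengaLunts1997, §3 (3.3) p. 13 L110–L112] -/
theorem isLefschetzPair_so (h2 : 2 ≤ finrank ℂ E) :
    IsLefschetzPair ℝ (⟨gradingElement E, gradingElement_mem_so E⟩ : so E) :=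
  (isJordanLefschetzPair_so E h2).isLefschetzPair

end Literature.Geometry.Kaehler.ComplexTorus
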